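import Literature.Analysis.Fourier.BeurlingFunction
import HarnessLib

/-!
# rh-explicit (venture WeilGRH): THE BEURLING–SELBERG FUNCTIONS OF A LATTICE WINDOW ARE FINITE `sinc` FORMS, I —
  telescoping, the lattice algebra, and the interior `0 < y < N`

Cell `rh-explicit`, WEIL TRACK (structure seat weil-3, gen13).  Pure real analysis (no measure, no zeta).

For an interval whose length is an INTEGER number `N` of unit steps, the Beurling–Selberg extremal majorant
and minorant of exponential type `2π` (Vaaler 1985, Thm. 8: `Δ = 1`, `Δ(b − a) = N ∈ ℕ`, the case in which
Selberg's functions ARE the extremal ones) collapse to FINITE combinations of `N ± 1` Fejér kernels at the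
lattice points and ONE cross term coupling the two endpoints:

  `M_N(y) = Σ_{m=0}^{N} sinc²(π(y−m)) − (−1)^N N·sinc(πy)·sinc(π(y−N)) ≥ 𝟙_{[0,N]}(y)`,
  `m_N(y) = Σ_{m=1}^{N−1} sinc²(π(y−m)) − (−1)^N N·sinc(πy)·sinc(π(y−N)) ≤ 𝟙_{(0,N)}(y)`      (all `y ∈ ℝ`)

(`∫ M_N = N + 1`, `∫ m_N = N − 1`).  Proof (elementary, this file): off the lattice every term carries the
common factor `sin²(πy)/π²`, the cross term is `(sin²(πy)/π²)(1/y + 1/(N−y))` by partial fractions, and the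
claim reduces, via `Σ_{n∈ℤ} sinc²(π(y+n)) = 1` (`Literature.Analysis.Fourier.hasSum_int_sinc_sq`), to the
telescoping comparisons `Σ_{k≥1}(z+k)⁻² ≤ 1/z ≤ Σ_{k≥0}(z+k)⁻²`.

This file (part I): the telescoping comparisons, the off-lattice algebra (`sinc_sq_sub_nat`, `cross_eq`), the
folded series `hasSum_sinc_sq_fold`, and the interior case — `one_le_selbergLattice_of_mem_Ioo` (`1 ≤ M_N(y)`)
and `selbergLattice_le_one_of_mem_Ioo` (`m_N(y) ≤ 1`) for `0 < y < N`, `y ∉ ℤ`.  Part II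
(`SelbergLatticeMinorant.lean`) does the exterior and the lattice points and assembles the two inequalities
for every `y`.  Used by `WeilSelbergWindows.lean`: with `y = a(t − c)/π` the `N + 2` functions involved are exactly the
critical-line transforms `‖û(½+it)‖²`, `û_c·û_{c+Nπ/a}` of flat windows of half-length `a` modulated to the
lattice heights `c + mπ/a`, so the Beurling–Selberg bounds for a Weil measure on a lattice window are finite
combinations of window forms (Yoshida Gram entries).

No definitions, no named facts; RH-free.
-/

set_option autoImplicit false

noncomputable section

open Real Set Filter Finset
open scoped Topology BigOperators

namespace Summit.Ventures.WeilGRH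

open Literature.Analysis.Fourier (sinc_pi_mul_add_nat_sq sinc_sq_le_one hasSum_int_sinc_sq)

/-! ## Telescoping comparisons for `Σ (z+k)⁻²` -/

/-- Upper telescoping: `Σ_{k<K} 1/(z+k+1)² ≤ 1/z − 1/(z+K) ` for `z > 0`. -/
theorem sum_inv_sq_succ_le {z : ℝ} (hz : 0 < z) (K : ℕ) :
    ∑ k ∈ Finset.range K, 1 / (z + k + 1) ^ 2 ≤ 1 / z - 1 / (z + K) := by
  induction K with
  | zero => simp
  | succ K ih =>
    rw [Finset.sum_range_succ]
    have hK : (0 : ℝ) ≤ K := Nat.cast_nonneg K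
    have h1 : 0 < z + K := by linarith
    have h2 : 0 < z + K + 1 := by linarith
    have hstep : 1 / (z + K + 1) ^ 2 ≤ 1 / (z + K) - 1 / (z + K + 1) := by
      rw [div_sub_div _ _ h1.ne' h2.ne', div_le_div_iff₀ (by positivity) (by positivity)]
      nlinarith
    have e : z + ((K : ℝ) + 1) = z + K + 1 := by ring
    push_cast
    rw [e]
    linarith

/-- Upper telescoping, uniform form: `Σ_{k<K} 1/(z+k+1)² ≤ 1/z` for `z > 0`. -/
theorem sum_inv_sq_succ_le_inv {z : ℝ} (hz : 0 < z) (K : ℕ) :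
    ∑ k ∈ Finset.range K, 1 / (z + k + 1) ^ 2 ≤ 1 / z := by
  have h : 0 ≤ 1 / (z + K) := by positivity
  linarith [sum_inv_sq_succ_le hz K]

/-- Lower telescoping: `1/z − 1/(z+K) ≤ Σ_{k<K} 1/(z+k)²` for `z > 0`. -/
theorem inv_sub_inv_le_sum_inv_sq {z : ℝ} (hz : 0 < z) (K : ℕ) :
    1 / z - 1 / (z + K) ≤ ∑ k ∈ Finset.range K, 1 / (z + k) ^ 2 := by
  induction K with
  | zero => simp
  | succ K ih =>
    rw [Finset.sum_range_succ]
    have hK : (0 : ℝ) ≤ K := Nat.cast_nonneg K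
    have h1 : 0 < z + K := by linarith
    have h2 : 0 < z + K + 1 := by linarith
    have hstep : 1 / (z + K) - 1 / (z + K + 1) ≤ 1 / (z + K) ^ 2 := by
      rw [div_sub_div _ _ h1.ne' h2.ne', div_le_div_iff₀ (by positivity) (by positivity)]
      nlinarith
    have e : z + ((K : ℝ) + 1) = z + K + 1 := by ring
    push_cast
    rw [e]
    linarith

/-! ## `sinc` at and off the integer lattice -/

/-- `sinc(πj) = 0` for a non-zero integer `j`. -/
theorem sinc_pi_mul_int_of_ne_zero {j : ℤ} (hj : j ≠ 0) : Real.sinc (π * j) = 0 := by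
  have hne : π * (j : ℝ) ≠ 0 := mul_ne_zero Real.pi_pos.ne' (by exact_mod_cast hj)
  rw [Real.sinc_of_ne_zero hne, mul_comm, Real.sin_int_mul_pi, zero_div]

/-- Off the lattice: `sinc(π(y − m))² = sin²(πy)/(π²(y−m)²)` (`m ∈ ℕ`, `y − m ≠ 0`). -/
theorem sinc_sq_sub_nat {y : ℝ} {m : ℕ} (h : y - m ≠ 0) :
    Real.sinc (π * (y - m)) ^ 2 = Real.sin (π * y) ^ 2 / (π ^ 2 * (y - m) ^ 2) := by
  have hne : π * (y - m) ≠ 0 := mul_ne_zero Real.pi_pos.ne' h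
  rw [Real.sinc_of_ne_zero hne, show π * (y - m) = π * y - m * π by ring, Real.sin_sub_nat_mul_pi,
    div_pow, mul_pow, ← pow_mul, show π * y - (m : ℝ) * π = π * (y - m) by ring, mul_pow]
  rw [show ((-1 : ℝ) ^ (m * 2)) = 1 by rw [pow_mul']; norm_num, one_mul]

/-- Off the endpoints: the cross term `−(−1)^N N·sinc(πy)·sinc(π(y−N)) = (sin²(πy)/π²)(1/y + 1/(N−y))`
(partial fractions `N/(y(N−y)) = 1/y + 1/(N−y)`). -/
theorem cross_eq {y : ℝ} {N : ℕ} (h0 : y ≠ 0) (hN : y - N ≠ 0) :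
    -((-1 : ℝ) ^ N * N * (Real.sinc (π * y) * Real.sinc (π * (y - N)))) =
      Real.sin (π * y) ^ 2 / π ^ 2 * (1 / y + 1 / (N - y)) := by
  have hπ := Real.pi_pos.ne'
  have hne0 : π * y ≠ 0 := mul_ne_zero hπ h0
  have hneN : π * (y - N) ≠ 0 := mul_ne_zero hπ hN
  have hN' : (N : ℝ) - y ≠ 0 := fun h ↦ hN (by linarith)
  rw [Real.sinc_of_ne_zero hne0, Real.sinc_of_ne_zero hneN,
    show π * (y - N) = π * y - N * π by ring, Real.sin_sub_nat_mul_pi]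
  rw [show π * y - (N : ℝ) * π = π * (y - N) by ring]
  obtain hσ | hσ : (-1 : ℝ) ^ N = 1 ∨ (-1 : ℝ) ^ N = -1 := by
    rcases Nat.even_or_odd N with h | h
    · exact Or.inl h.neg_one_pow
    · exact Or.inr h.neg_one_pow
  all_goals rw [hσ]; field_simp; ring

/-! ## The two-sided `sinc²` series, folded over `ℕ` -/

/-- `Σ_{n∈ℤ} sinc²(π(y+n)) = 1`, folded: the `ℕ`-indexed series `sinc²(π(y+n)) + sinc²(π(y−(n+1)))` has
sum `1`. -/
theorem hasSum_sinc_sq_fold (y : ℝ) :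
    HasSum (fun n : ℕ ↦ Real.sinc (π * (y + n)) ^ 2 + Real.sinc (π * (y - (n + 1))) ^ 2) 1 := by
  have h := (hasSum_int_sinc_sq y).nat_add_neg_add_one
  refine h.congr_fun fun n ↦ ?_
  push_cast
  ring_nf

/-- Partial sums of the folded series are at most `1`. -/
theorem sum_sinc_sq_fold_le_one (y : ℝ) (K : ℕ) :
    ∑ n ∈ Finset.range K, (Real.sinc (π * (y + n)) ^ 2 + Real.sinc (π * (y - (n + 1))) ^ 2) ≤ 1 :=
  sum_le_hasSum (Finset.range K) (fun n _ ↦ by positivity) (hasSum_sinc_sq_fold y)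

/-- Partial sums of the folded series tend to `1`. -/
theorem tendsto_sum_sinc_sq_fold (y : ℝ) :
    Tendsto (fun K : ℕ ↦ ∑ n ∈ Finset.range K,
      (Real.sinc (π * (y + n)) ^ 2 + Real.sinc (π * (y - (n + 1))) ^ 2)) atTop (𝓝 1) :=
  (hasSum_sinc_sq_fold y).tendsto_sum_nat


/-! ## Off the lattice: the interior `0 < y < N` -/

/-- Off-lattice bookkeeping: `y ∉ ℤ` forbids `y = m`, `y = −n`. -/
theorem sub_nat_ne_zero_of_forall_ne {y : ℝ} (hy : ∀ k : ℤ, y ≠ k) (m : ℕ) : y - m ≠ 0 :=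
  fun h ↦ hy m (by push_cast; linarith)

/-- Off-lattice bookkeeping: `y ∉ ℤ` forbids `y = −n`. -/
theorem add_nat_ne_zero_of_forall_ne {y : ℝ} (hy : ∀ k : ℤ, y ≠ k) (n : ℕ) : y + n ≠ 0 :=
  fun h ↦ hy (-(n : ℤ)) (by push_cast; linarith)

/-- The folded series in closed form off the lattice: its `n`-th term is
`(sin²(πy)/π²)(1/(y+n)² + 1/(y−(n+1))²)`. -/
theorem sinc_sq_fold_eq {y : ℝ} (hy : ∀ k : ℤ, y ≠ k) (n : ℕ) :
    Real.sinc (π * (y + n)) ^ 2 + Real.sinc (π * (y - (n + 1))) ^ 2 =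
      Real.sin (π * y) ^ 2 / π ^ 2 * (1 / (y + n) ^ 2 + 1 / (y - (n + 1)) ^ 2) := by
  have h1 := sinc_pi_mul_add_nat_sq (add_nat_ne_zero_of_forall_ne hy n)
  have h2 := sinc_sq_sub_nat (sub_nat_ne_zero_of_forall_ne hy (n + 1))
  push_cast at h2
  rw [h1, h2]
  have hπ : (π : ℝ) ^ 2 ≠ 0 := by positivity
  have ha := add_nat_ne_zero_of_forall_ne hy n
  have hb : y - ((n : ℝ) + 1) ≠ 0 := by
    have := sub_nat_ne_zero_of_forall_ne hy (n + 1); push_cast at this; exact this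
  field_simp

/-- **Interior majorant** (`0 < y < N`, `y ∉ ℤ`): `1 ≤ M_N(y)`. -/
theorem one_le_selbergLattice_of_mem_Ioo {y : ℝ} {N : ℕ} (hy : ∀ k : ℤ, y ≠ k) (h0 : 0 < y)
    (hN : y < N) :
    1 ≤ (∑ m ∈ Finset.range (N + 1), Real.sinc (π * (y - m)) ^ 2) -
      (-1) ^ N * N * (Real.sinc (π * y) * Real.sinc (π * (y - N))) := by
  set S : ℝ := Real.sin (π * y) ^ 2 / π ^ 2 with hSdef
  have hS : 0 ≤ S := by positivity
  have hNy : 0 < (N : ℝ) - y := by linarith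
  have hcross := cross_eq (N := N) h0.ne' (sub_nat_ne_zero_of_forall_ne hy N)
  -- the partial sums of the folded series are bounded by `R`
  set R : ℝ := Real.sinc (π * y) ^ 2 + (∑ n ∈ Finset.range N, Real.sinc (π * (y - (n + 1))) ^ 2) +
    S * (1 / y + 1 / (N - y)) with hRdef
  have hbound : ∀ K : ℕ, ∑ n ∈ Finset.range K,
      (Real.sinc (π * (y + n)) ^ 2 + Real.sinc (π * (y - (n + 1))) ^ 2) ≤ R := by
    intro K
    rw [Finset.sum_add_distrib]
    -- left family: `n = 0` is the lattice point `0`, `n ≥ 1` is outside on the left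
    have hL : ∑ n ∈ Finset.range K, Real.sinc (π * (y + n)) ^ 2 ≤ Real.sinc (π * y) ^ 2 + S * (1 / y) := by
      calc ∑ n ∈ Finset.range K, Real.sinc (π * (y + n)) ^ 2
          ≤ ∑ n ∈ Finset.range (K + 1), Real.sinc (π * (y + n)) ^ 2 :=
            Finset.sum_le_sum_of_subset_of_nonneg (Finset.range_subset_range.2 (Nat.le_succ K))
              (fun n _ _ ↦ by positivity)
        _ = (∑ n ∈ Finset.range K, Real.sinc (π * (y + ((n + 1 : ℕ) : ℝ))) ^ 2) + Real.sinc (π * (y + ((0 : ℕ) : ℝ))) ^ 2 :=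
            Finset.sum_range_succ' _ _
        _ = (∑ n ∈ Finset.range K, S * (1 / (y + n + 1) ^ 2)) + Real.sinc (π * y) ^ 2 := by
            congr 1
            · refine Finset.sum_congr rfl fun n _ ↦ ?_
              rw [sinc_pi_mul_add_nat_sq (add_nat_ne_zero_of_forall_ne hy (n + 1)), hSdef]
              have hne : y + (n : ℝ) + 1 ≠ 0 := by
                have := add_nat_ne_zero_of_forall_ne hy (n + 1); push_cast at this; linarith [this]
              have hπ : (π : ℝ) ≠ 0 := Real.pi_pos.ne'
              push_cast
              field_simp
              ring
            · simp
        _ ≤ S * (1 / y) + Real.sinc (π * y) ^ 2 := by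
            rw [← Finset.mul_sum]
            have := mul_le_mul_of_nonneg_left (sum_inv_sq_succ_le_inv h0 K) hS
            linarith
        _ = Real.sinc (π * y) ^ 2 + S * (1 / y) := add_comm _ _
    -- right family: `n < N` are the lattice points `1 … N`, `n ≥ N` is outside on the right
    have hR : ∑ n ∈ Finset.range K, Real.sinc (π * (y - (n + 1))) ^ 2 ≤
        (∑ n ∈ Finset.range N, Real.sinc (π * (y - (n + 1))) ^ 2) + S * (1 / (N - y)) := by
      calc ∑ n ∈ Finset.range K, Real.sinc (π * (y - (n + 1))) ^ 2
          ≤ ∑ n ∈ Finset.range (N + K), Real.sinc (π * (y - (n + 1))) ^ 2 :=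
            Finset.sum_le_sum_of_subset_of_nonneg (Finset.range_subset_range.2 (Nat.le_add_left K N))
              (fun n _ _ ↦ by positivity)
        _ = (∑ n ∈ Finset.range N, Real.sinc (π * (y - (n + 1))) ^ 2) +
              ∑ k ∈ Finset.range K, Real.sinc (π * (y - (((N + k : ℕ) : ℝ) + 1))) ^ 2 :=
            Finset.sum_range_add _ _ _
        _ = (∑ n ∈ Finset.range N, Real.sinc (π * (y - (n + 1))) ^ 2) +
              ∑ k ∈ Finset.range K, S * (1 / ((N - y) + k + 1) ^ 2) := by
            congr 1
            refine Finset.sum_congr rfl fun k _ ↦ ?_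
            have h := sinc_sq_sub_nat (sub_nat_ne_zero_of_forall_ne hy (N + k + 1))
            push_cast at h ⊢
            rw [h, hSdef]
            have hk : (0 : ℝ) ≤ k := Nat.cast_nonneg k
            have hne : (N : ℝ) - y + k + 1 ≠ 0 := by linarith
            have hne' : y - ((N : ℝ) + k + 1) ≠ 0 := by linarith
            have hπ : (π : ℝ) ≠ 0 := Real.pi_pos.ne'
            have hsq : (y - ((N : ℝ) + k + 1)) ^ 2 = ((N : ℝ) - y + k + 1) ^ 2 := by ring
            rw [hsq]
            field_simp
        _ ≤ (∑ n ∈ Finset.range N, Real.sinc (π * (y - (n + 1))) ^ 2) + S * (1 / (N - y)) := by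
            rw [← Finset.mul_sum]
            have := mul_le_mul_of_nonneg_left (sum_inv_sq_succ_le_inv hNy K) hS
            linarith
    rw [hRdef]
    linarith
  have h1R : 1 ≤ R := le_of_tendsto' (tendsto_sum_sinc_sq_fold y) hbound
  -- `M_N(y) = R`
  have hM : (∑ m ∈ Finset.range (N + 1), Real.sinc (π * (y - m)) ^ 2) -
      (-1) ^ N * N * (Real.sinc (π * y) * Real.sinc (π * (y - N))) = R := by
    rw [sub_eq_add_neg, hcross, Finset.sum_range_succ', hRdef, hSdef]
    push_cast
    simp only [sub_zero]
    ring
  rw [hM]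
  exact h1R

/-- **Interior minorant** (`0 < y < N`, `y ∉ ℤ`): `m_N(y) ≤ 1`. -/
theorem selbergLattice_le_one_of_mem_Ioo {y : ℝ} {N : ℕ} (hy : ∀ k : ℤ, y ≠ k) (h0 : 0 < y)
    (hN : y < N) :
    (∑ m ∈ Finset.Ico 1 N, Real.sinc (π * (y - m)) ^ 2) -
      (-1) ^ N * N * (Real.sinc (π * y) * Real.sinc (π * (y - N))) ≤ 1 := by
  have hN1 : 1 ≤ N := by
    rcases Nat.eq_zero_or_pos N with h | h
    · subst h; simp at hN; linarith
    · exact h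
  set S : ℝ := Real.sin (π * y) ^ 2 / π ^ 2 with hSdef
  have hS : 0 ≤ S := by positivity
  have hNy : 0 < (N : ℝ) - y := by linarith
  have hcross := cross_eq (N := N) h0.ne' (sub_nat_ne_zero_of_forall_ne hy N)
  set B : ℝ := ∑ n ∈ Finset.range (N - 1), Real.sinc (π * (y - (n + 1))) ^ 2 with hBdef
  -- lower bound for the partial sums over `range (N - 1 + K)`
  have hbound : ∀ K : ℕ, B + S * ((1 / y - 1 / (y + ((N - 1 + K : ℕ) : ℝ))) + (1 / (N - y) - 1 / ((N - y) + K))) ≤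
      ∑ n ∈ Finset.range (N - 1 + K),
        (Real.sinc (π * (y + n)) ^ 2 + Real.sinc (π * (y - (n + 1))) ^ 2) := by
    intro K
    rw [Finset.sum_add_distrib]
    have hL : S * (1 / y - 1 / (y + ((N - 1 + K : ℕ) : ℝ))) ≤
        ∑ n ∈ Finset.range (N - 1 + K), Real.sinc (π * (y + n)) ^ 2 := by
      calc S * (1 / y - 1 / (y + ((N - 1 + K : ℕ) : ℝ)))
          ≤ S * ∑ n ∈ Finset.range (N - 1 + K), 1 / (y + n) ^ 2 :=
            mul_le_mul_of_nonneg_left (inv_sub_inv_le_sum_inv_sq h0 _) hS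
        _ = ∑ n ∈ Finset.range (N - 1 + K), Real.sinc (π * (y + n)) ^ 2 := by
            rw [Finset.mul_sum]
            refine Finset.sum_congr rfl fun n _ ↦ ?_
            rw [sinc_pi_mul_add_nat_sq (add_nat_ne_zero_of_forall_ne hy n), hSdef]
            have hne := add_nat_ne_zero_of_forall_ne hy n
            have hπ : (π : ℝ) ≠ 0 := Real.pi_pos.ne'
            field_simp
    have hR : B + S * (1 / (N - y) - 1 / ((N - y) + K)) ≤
        ∑ n ∈ Finset.range (N - 1 + K), Real.sinc (π * (y - (n + 1))) ^ 2 := by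
      rw [Finset.sum_range_add, hBdef]
      gcongr
      calc S * (1 / (N - y) - 1 / ((N - y) + K))
          ≤ S * ∑ k ∈ Finset.range K, 1 / ((N - y) + k) ^ 2 :=
            mul_le_mul_of_nonneg_left (inv_sub_inv_le_sum_inv_sq hNy K) hS
        _ = ∑ k ∈ Finset.range K, Real.sinc (π * (y - (((N - 1 + k : ℕ) : ℝ) + 1))) ^ 2 := by
            rw [Finset.mul_sum]
            refine Finset.sum_congr rfl fun k _ ↦ ?_
            have h := sinc_sq_sub_nat (sub_nat_ne_zero_of_forall_ne hy (N - 1 + k + 1))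
            have hcast : (((N - 1 + k + 1 : ℕ) : ℝ)) = (N : ℝ) + k := by
              rw [show N - 1 + k + 1 = N + k by omega]; push_cast; ring
            have hcast' : (((N - 1 + k : ℕ) : ℝ)) + 1 = (N : ℝ) + k := by
              rw [← hcast]; push_cast; ring
            rw [hcast] at h
            rw [hcast', h, hSdef]
            have hk : (0 : ℝ) ≤ k := Nat.cast_nonneg k
            have hne : (N : ℝ) - y + k ≠ 0 := by linarith
            have hne' : y - ((N : ℝ) + k) ≠ 0 := by linarith
            have hπ : (π : ℝ) ≠ 0 := Real.pi_pos.ne'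
            have hsq : (y - ((N : ℝ) + k)) ^ 2 = ((N : ℝ) - y + k) ^ 2 := by ring
            rw [hsq]
            field_simp
    linarith
  have hle : ∀ K : ℕ, B + S * (1 / y + 1 / (N - y)) -
      S * (1 / (y + ((N - 1 + K : ℕ) : ℝ)) + 1 / ((N - y) + K)) ≤ 1 := by
    intro K
    have h1 := hbound K
    have h2 := sum_sinc_sq_fold_le_one y (N - 1 + K)
    have : B + S * (1 / y + 1 / (N - y)) - S * (1 / (y + ((N - 1 + K : ℕ) : ℝ)) + 1 / ((N - y) + K)) =
        B + S * ((1 / y - 1 / (y + ((N - 1 + K : ℕ) : ℝ))) + (1 / (N - y) - 1 / ((N - y) + K))) := by ring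
    linarith
  -- the error term tends to `0`
  have hε : Tendsto (fun K : ℕ ↦ S * (1 / (y + ((N - 1 + K : ℕ) : ℝ)) + 1 / ((N - y) + K))) atTop (𝓝 0) := by
    have hA : Tendsto (fun K : ℕ ↦ y + ((N - 1 + K : ℕ) : ℝ)) atTop atTop := by
      have : (fun K : ℕ ↦ y + ((N - 1 + K : ℕ) : ℝ)) = fun K : ℕ ↦ (y + ((N - 1 : ℕ) : ℝ)) + (K : ℝ) := by
        funext K; push_cast; ring
      rw [this]
      exact tendsto_atTop_add_const_left atTop _ tendsto_natCast_atTop_atTop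
    have hB : Tendsto (fun K : ℕ ↦ ((N : ℝ) - y) + K) atTop atTop :=
      tendsto_atTop_add_const_left atTop _ tendsto_natCast_atTop_atTop
    have h1 : Tendsto (fun K : ℕ ↦ (1 : ℝ) / (y + ((N - 1 + K : ℕ) : ℝ))) atTop (𝓝 0) :=
      tendsto_const_nhds.div_atTop hA
    have h2 : Tendsto (fun K : ℕ ↦ (1 : ℝ) / (((N : ℝ) - y) + K)) atTop (𝓝 0) :=
      tendsto_const_nhds.div_atTop hB
    have := (h1.add h2).const_mul S
    simpa using this
  have hmain : B + S * (1 / y + 1 / (N - y)) ≤ 1 := by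
    have hlim : Tendsto (fun K : ℕ ↦ B + S * (1 / y + 1 / (N - y)) -
        S * (1 / (y + ((N - 1 + K : ℕ) : ℝ)) + 1 / ((N - y) + K))) atTop (𝓝 (B + S * (1 / y + 1 / (N - y)) - 0)) :=
      tendsto_const_nhds.sub hε
    rw [sub_zero] at hlim
    exact le_of_tendsto' hlim hle
  -- `m_N(y) = B + S(1/y + 1/(N−y))`
  have hm : (∑ m ∈ Finset.Ico 1 N, Real.sinc (π * (y - m)) ^ 2) -
      (-1) ^ N * N * (Real.sinc (π * y) * Real.sinc (π * (y - N))) = B + S * (1 / y + 1 / (N - y)) := by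
    rw [sub_eq_add_neg, hcross, hBdef, hSdef, Finset.sum_Ico_eq_sum_range]
    congr 1
    refine Finset.sum_congr rfl fun n _ ↦ ?_
    push_cast
    ring_nf
  rw [hm]
  exact hmain

end Summit.Ventures.WeilGRH

end
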